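import Literature.NumberTheory.LFunctions.Zhang2022.Section12Eq1216EdgeExact
import Literature.NumberTheory.LFunctions.Zhang2022.Section12Low1522Leaves
import Literature.NumberTheory.LFunctions.Zhang2022.TypedSection12CExact

/-!
# Zhang (2022) §12: the leaf (12.16) `Eq1216` CLOSED modulo the exact-reading top-range node `Top1522Ex`

Topic `Literature/NumberTheory/LFunctions/Zhang2022` (Landau–Siegel audit tree; verdict-neutral).
Y. Zhang, *Discrete mean estimates and the Landau–Siegel zero*, arXiv:2211.02515v1 (2022)
[Zhang2022LandauSiegel]. **Status of the source: an unrefereed manuscript under adjudication**; everything in this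
file is PROVED (theorems only; no new definitions, no new facts); nothing here is a claim about Theorems 1–2 of the
source or about Landau–Siegel zeros.

vs PRINT: (12.16) (p. 73, tex L3710) "`(1/2α)S₁(𝐚₁₅,𝐚₂₂) + (2/α)S₂(𝐚₁₅,𝐚₂₂) + (3/2α)S₃(𝐚₁₅,𝐚₂₂) = 𝔞(conj e₂* + ε/2)`"
is the typed leaf `Typed.Sec12C.Eq1216 c′` AS PRINTED (slack `10⁻⁵𝔞/2`); it is derived here from the EQUIVALENT
exact-weight reading of the p. 73 top range (`Typed.Sec12C.Top1522Ex`, the lane's node of record replacing `Step12u049`,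
ruling R-18: Zhang's own `𝓦*_j` of the proof of Lemma 12.1 kept exact, `o(α)`, no `ε₁ⱼ`-slack) and the now-unconditional
low range (`Typed.Sec12C.low1522_holds`, "the first sum contributes `o(α)`").

* **`eq1216_of_top1522Ex : Top1522Ex c′ → Eq1216 c′`** — by `Sec12D.eq1216_of_low1522_top1522Ex_shape`
  (`Section12Eq1216EdgeExact`: split `S_j = S_j|_{dr≤P″₁} + S_j|_{P″₁<dr<P₂}`, weights of Prop. 7.1 against `α log P = π`,
  `‖𝓦*ˣ_j(P^z) − wStarExact_j(z)‖ ≤ 10⁻⁵` for `D ≥ D₀(c′)`, kernel box `‖e2starBarW wStarExact − conj e₂*‖ < 3.3·10⁻⁶`;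
  budget `3.85·10⁻⁶ ≤ 5·10⁻⁶`) at `hLow := low1522_holds c′`; the hypothesis `Top1522Ex` unfolds
  (`main12u049intEx`, `frakwStarEx`) literally to the shape of that theorem.
* `eq1216_of_top1522Ex_all` — the same in the skeleton's binder currency `∀ c′ ≥ c₁`.

So the hypothesis `h1216` of `Skeleton.theorem1_of_leaves` is a THEOREM of the hypothesis `hTop1522` (binder of record
after R-18): `h1216 := fun c' hc => eq1216_of_top1522Ex c' (hTop1522 c' hc)`.

## References

* Y. Zhang, arXiv:2211.02515v1 (2022), §12 p. 73, (12.16); p. 68 (proof of Lemma 12.1). [cite: Zhang2022LandauSiegel, §12 (12.16) p.73]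
-/

noncomputable section

open Complex Real ComplexConjugate
open Literature.NumberTheory.LFunctions.Zhang2022
open Literature.NumberTheory.LFunctions.Zhang2022.Skeleton
open Literature.NumberTheory.LFunctions.Zhang2022.Typed.Sec12C

namespace Literature.NumberTheory.LFunctions.Zhang2022.Sec12D

variable (c' : ℝ)

/-- **(12.16) ⇐ the exact-reading top-range node of p. 73**: `Top1522Ex c′ → Eq1216 c′` (the low range
"contributes `o(α)`" is the theorem `low1522_holds`). [cite: Zhang2022LandauSiegel, §12 (12.16) p.73] -/
theorem eq1216_of_top1522Ex (h : Top1522Ex c') : Eq1216 c' :=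
  eq1216_of_low1522_top1522Ex_shape c' (low1522_holds c')
    (by simpa only [Top1522Ex, main12u049intEx, frakwStarEx] using h)

/-- The same in the binder currency of `theorem1_of_leaves` (`∀ c′ ≥ c₁`). [cite: Zhang2022LandauSiegel, §12 (12.16) p.73] -/
theorem eq1216_of_top1522Ex_all {c₁ : ℝ} (h : ∀ c' : ℝ, c₁ ≤ c' → Top1522Ex c') :
    ∀ c' : ℝ, c₁ ≤ c' → Eq1216 c' :=
  fun c' hc => eq1216_of_top1522Ex c' (h c' hc)

end Literature.NumberTheory.LFunctions.Zhang2022.Sec12D
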